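import Summits.ResolutionOfSingularities.ResolutionOfSingularities.Theorems.WeightedInvariantTraceDescent
import Summits.ResolutionOfSingularities.ResolutionOfSingularities.Theorems.WeightedInvariantIota3JFlat
import HarnessLib

/-!
# GALOIS DESCENT OF σ-MAXIMISERS: along a flat local map with 𝔪-extension carrying a trace-descent datum, a σ-maximiser upstairs
# whose filtration is canonical ((J-can)) descends to a σ-maximiser downstairs with the same filtration; hence `jSigmaPtLocal`
# commutes with the map («(G3)+(G4)» of the Galois route; door `HypersurfaceCentreConstruction`, stmt-ResolutionOfSingularities-19897;
# P3 rung (c11σ)/GAP 2; hand res-L1-w43-stub-3)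

Topic: `Summits/ResolutionOfSingularities/ResolutionOfSingularities/Theorems`. Helper for the door item
`HypersurfaceCentreConstruction` (stmt-ResolutionOfSingularities-19897, route `WeightedInvariant`), line `local-engine` (L W4.3),
def-free.

**Setting.** `φ : S → S'` flat, local rings, `𝔪_S S' = 𝔪_{S'}`; a finite family `Γ` of `S`-algebra AUTOMORPHISMS of `S'` with a
trace-descent datum `(t, b, c)` (`φ ∘ t = Σ_γ γ`, `x = Σᵢ φ(t(x bᵢ)) cᵢ` — e.g. `S' = S ⊗_k L`, `L/k` finite Galois, p-TraceDescent);
`f ∈ S`, `ν = ord(φ f)`.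

* §1 `isSigmaMaximiser_algEquiv_iff`: `S`-automorphisms of `S'` permute the σ-maximisers of `φ f` (they fix `φ f`).
* §2 `stable_of_canonical`: under (J-can) at `(S', φ f)` (SPEC (Δ12) `JSigmaCanonicalAt`, INLINED as a hypothesis text) the two
  levels `F'(r₁), F'(r₂)` of a primitive σ-maximiser are `Γ`-stable.
* §3 **`exists_isSigmaMaximiser_of_galois`**: such a maximiser DESCENDS — a two-flag `(g₁, g₂)` of `S` with
  `F_{φg₁,φg₂} = F'` which is a σ-maximiser of `f` (same triple, same `ν`) — by «LEMMA R» (p567714) + trace descent (…TraceDescent).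
* §4 **`jSigmaPtLocal_map_eq_of_galois`**: with (J-can) at BOTH `(S, f)` and `(S', φ f)` and (EX) at `(S', φ f)`:
  `jSigmaPtLocal (φ f) m = (jSigmaPtLocal f m)·S'` for all `m` — the shape of GAP 2's `hσ` in p555186 `jFlatT_map_of_sigma`.
* §5–§6 (J-can) and (EX) THEMSELVES DESCEND (`canonical_of_galois`, `exists_of_galois`; images of maximisers are maximisers,
  `isSigmaMaximiser_algebraMap_of_galois`; `lexLE_trans`), so **`jSigmaPtLocal_map_eq_of_galois'`** needs (J-can)+(EX) UPSTAIRS only.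

Scope: this is the residue-GALOIS part of (c11σ); purely transcendental residue extensions are res-type-057's generic-fibre
specialisation (p542470), completions its dense descent; two-flag reach does NOT descend in general (memo O53-DESC-CEX), which is why
canonicity (J-can) — res-D-brk-1's (o70-b), closed modulo `SigmaOneSidedDominanceLE3Body` — enters.

[OURS · L1 W4.3 · (o53-desc′) (G3)/(G4)]  Replaces the role of NO printed item; NOT a statement of the manuscript
[claim: Hironaka2017, status: under-review]. AI work, weaker than expert review.  No named facts (hypotheses (J-can)/(EX) are carried
as explicit binders, SPEC (Δ12) texts).

## References

* H. Hironaka, *Characteristic polyhedra of singularities*, J. Math. Kyoto Univ. 7 (1967), §3. [Hironaka1967]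
* A. Grothendieck, *EGA IV*, Publ. Math. IHÉS 20 (1964), 0_IV (19.7.1). [EGA0IV]
-/

noncomputable section

open IsLocalRing Literature.AlgebraicGeometry.Resolution
open Summit.ResolutionOfSingularities.ResolutionOfSingularities.Cruxes.HypersurfaceCentreConstruction.LocalEngine
open Summit.ResolutionOfSingularities.ResolutionOfSingularities.Cruxes.HypersurfaceCentreConstruction.LocalEngine.Iota3

set_option linter.dupNamespace false -- mandated namespace of this single-conjunct summit

namespace Summit.ResolutionOfSingularities.ResolutionOfSingularities.Theorems

namespace SigmaGaloisDescent

variable {S S' : Type} [CommRing S] [CommRing S'] [IsLocalRing S] [IsLocalRing S'] [Algebra S S'] [Module.Flat S S']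

/-! ## §1 Automorphisms permute maximisers -/

omit [IsLocalRing S] [Module.Flat S S'] in
/-- An `S`-algebra automorphism of `S'` permutes the σ-maximisers of `φ f`. [folklore] -/
theorem isSigmaMaximiser_algEquiv_iff (γ : S' ≃ₐ[S] S') (f : S) (ν : ℕ) (g₁ g₂ : S') (q r₁ r₂ : ℕ) :
    IsSigmaMaximiser (algebraMap S S' f) ν (γ g₁) (γ g₂) q r₁ r₂ ↔
      IsSigmaMaximiser (algebraMap S S' f) ν g₁ g₂ q r₁ r₂ := by
  have h := isSigmaMaximiser_ringEquiv_iff (γ : S' ≃+* S') (algebraMap S S' f) ν g₁ g₂ q r₁ r₂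
  rw [AlgEquiv.coe_ringEquiv, AlgEquiv.commutes] at h
  exact h

omit [IsLocalRing S] [Module.Flat S S'] in
/-- An automorphism preserves `𝔪'`. [folklore] -/
theorem map_maximalIdeal_algEquiv_le (γ : S' ≃ₐ[S] S') :
    (maximalIdeal S').map ((γ : S' →ₐ[S] S') : S' →+* S') ≤ maximalIdeal S' := by
  rw [Ideal.map_le_iff_le_comap]
  intro x hx
  rw [Ideal.mem_comap]
  exact (IsLocalRing.mem_maximalIdeal _).mpr fun hu => (IsLocalRing.mem_maximalIdeal _).mp hx
    (by simpa using hu.map (γ.symm : S' ≃ₐ[S] S'))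

/-! ## §2 (J-can) makes the maximiser levels stable -/

omit [IsLocalRing S] [Module.Flat S S'] in
/-- Under (J-can) at `(S', φ f)` the filtration of a primitive σ-maximiser is fixed by every `S`-automorphism. [folklore] -/
theorem flagContactFiltration_algEquiv_eq_of_canonical {f : S}
    (hcan : ∀ (g₁ g₂ : S') (q r₁ r₂ : ℕ) (g₁' g₂' : S') (q' r₁' r₂' : ℕ),
      IsSigmaMaximiser (algebraMap S S' f) (adicOrder (algebraMap S S' f)).toNat g₁ g₂ q r₁ r₂ → IsPrimitiveTriple q r₁ r₂ →
      IsSigmaMaximiser (algebraMap S S' f) (adicOrder (algebraMap S S' f)).toNat g₁' g₂' q' r₁' r₂' →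
      IsPrimitiveTriple q' r₁' r₂' →
      ∀ m : ℕ, flagContactFiltration g₁' g₂' q' r₁' r₂' m = flagContactFiltration g₁ g₂ q r₁ r₂ m)
    {g₁ g₂ : S'} {q r₁ r₂ : ℕ} (hmax : IsSigmaMaximiser (algebraMap S S' f) (adicOrder (algebraMap S S' f)).toNat g₁ g₂ q r₁ r₂)
    (hprim : IsPrimitiveTriple q r₁ r₂) (γ : S' ≃ₐ[S] S') (m : ℕ) :
    flagContactFiltration (γ g₁) (γ g₂) q r₁ r₂ m = flagContactFiltration g₁ g₂ q r₁ r₂ m :=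
  hcan g₁ g₂ q r₁ r₂ (γ g₁) (γ g₂) q r₁ r₂ hmax hprim ((isSigmaMaximiser_algEquiv_iff γ f _ g₁ g₂ q r₁ r₂).mpr hmax) hprim m

/-! ## §3 Descent of a σ-maximiser -/

/-- **GALOIS DESCENT OF A σ-MAXIMISER.**  `φ : S → S'` flat local with `𝔪S' = 𝔪'`, a finite family `Γ` of `S`-automorphisms of `S'`
with a trace-descent datum; (J-can) at `(S', φ f)`.  Then every primitive σ-maximiser `(g₁', g₂'; q, r₁, r₂)` of `φ f` descends: a
two-flag `(g₁, g₂)` of `S` with `flagContactFiltration (φ g₁) (φ g₂) q r₁ r₂ = flagContactFiltration g₁' g₂' q r₁ r₂` (all degrees)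
which is a σ-maximiser of `f` for the same triple and the same `ν`. [cite: Hironaka1967, §3] [cite: EGA0IV, 0_IV (19.7.1)]
[OURS · L1 W4.3 · (o53-desc′) (G4)] -/
theorem exists_isSigmaMaximiser_of_galois (h𝔪 : (maximalIdeal S).map (algebraMap S S') = maximalIdeal S')
    {κ ι : Type*} [Fintype κ] [Fintype ι] (Γ : κ → (S' ≃ₐ[S] S')) (t : S' → S)
    (ht : ∀ y, algebraMap S S' (t y) = ∑ k, Γ k y) (b c : ι → S')
    (hdual : ∀ x, x = ∑ i, algebraMap S S' (t (x * b i)) * c i) {f : S}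
    (hcan : ∀ (g₁ g₂ : S') (q r₁ r₂ : ℕ) (g₁' g₂' : S') (q' r₁' r₂' : ℕ),
      IsSigmaMaximiser (algebraMap S S' f) (adicOrder (algebraMap S S' f)).toNat g₁ g₂ q r₁ r₂ → IsPrimitiveTriple q r₁ r₂ →
      IsSigmaMaximiser (algebraMap S S' f) (adicOrder (algebraMap S S' f)).toNat g₁' g₂' q' r₁' r₂' →
      IsPrimitiveTriple q' r₁' r₂' →
      ∀ m : ℕ, flagContactFiltration g₁' g₂' q' r₁' r₂' m = flagContactFiltration g₁ g₂ q r₁ r₂ m)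
    {g₁' g₂' : S'} {q r₁ r₂ : ℕ}
    (hmax : IsSigmaMaximiser (algebraMap S S' f) (adicOrder (algebraMap S S' f)).toNat g₁' g₂' q r₁ r₂)
    (hprim : IsPrimitiveTriple q r₁ r₂) :
    ∃ g₁ g₂ : S, IsSigmaMaximiser f (adicOrder (algebraMap S S' f)).toNat g₁ g₂ q r₁ r₂ ∧
      ∀ n, flagContactFiltration (algebraMap S S' g₁) (algebraMap S S' g₂) q r₁ r₂ n =
        flagContactFiltration g₁' g₂' q r₁ r₂ n := by
  obtain ⟨hadm, hfl', hmem, hlex⟩ := hmax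
  -- the two levels are `Γ`-stable by (J-can)
  have hst : ∀ lvl, ∀ k, ∀ x ∈ flagContactFiltration g₁' g₂' q r₁ r₂ lvl,
      (Γ k : S' →ₐ[S] S') x ∈ flagContactFiltration g₁' g₂' q r₁ r₂ lvl := fun lvl =>
    TraceDescent.stable_of_forall_eq (fun k => (Γ k : S' →ₐ[S] S')) (fun k => map_maximalIdeal_algEquiv_le (Γ k))
      g₁' g₂' q r₁ r₂ lvl (fun k => flagContactFiltration_algEquiv_eq_of_canonical hcan ⟨hadm, hfl', hmem, hlex⟩ hprim (Γ k) lvl)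
  obtain ⟨g₁, g₂, hfl, heq⟩ := TraceDescent.exists_isTwoFlag_eq_of_stable h𝔪 (fun k => (Γ k : S' →ₐ[S] S')) t ht b c
    hdual hfl' hadm (hst r₁) (hst r₂)
  refine ⟨g₁, g₂, ⟨hadm, hfl, ?_, fun q' r₁' r₂' hadm' hreach => hlex q' r₁' r₂' hadm' (hreach.algebraMap_of_flat h𝔪)⟩, heq⟩
  rw [← heq, ← map_flagContactFiltration_eq (algebraMap S S') h𝔪] at hmem
  exact (mem_iff_algebraMap_mem_map_of_flat h𝔪 _ f).mpr hmem

/-! ## §4 `jSigmaPtLocal` commutes with `φ` -/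

/-- Under (J-can) the sup defining `jSigmaPtLocal` is any single primitive maximiser's filtration. [folklore] -/
theorem jSigmaPtLocal_eq_of_canonical {R : Type} [CommRing R] [IsLocalRing R] {f : R} (hf0 : f ≠ 0) (hfu : ¬ IsUnit f)
    (hcan : ∀ (g₁ g₂ : R) (q r₁ r₂ : ℕ) (g₁' g₂' : R) (q' r₁' r₂' : ℕ),
      IsSigmaMaximiser f (adicOrder f).toNat g₁ g₂ q r₁ r₂ → IsPrimitiveTriple q r₁ r₂ →
      IsSigmaMaximiser f (adicOrder f).toNat g₁' g₂' q' r₁' r₂' → IsPrimitiveTriple q' r₁' r₂' →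
      ∀ m : ℕ, flagContactFiltration g₁' g₂' q' r₁' r₂' m = flagContactFiltration g₁ g₂ q r₁ r₂ m)
    {g₁ g₂ : R} {q r₁ r₂ : ℕ} (hmax : IsSigmaMaximiser f (adicOrder f).toNat g₁ g₂ q r₁ r₂) (hprim : IsPrimitiveTriple q r₁ r₂)
    (m : ℕ) : jSigmaPtLocal f m = flagContactFiltration g₁ g₂ q r₁ r₂ m := by
  rw [jSigmaPtLocal_of_ne hf0 hfu]
  refine le_antisymm ?_ ?_
  · refine iSup_le fun g₁' => iSup_le fun g₂' => iSup_le fun q' => iSup_le fun r₁' => iSup_le fun r₂' => iSup_le fun h' => ?_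
    exact (hcan g₁ g₂ q r₁ r₂ g₁' g₂' q' r₁' r₂' hmax hprim h'.1 h'.2 m).le
  · exact le_iSup_of_le g₁ (le_iSup_of_le g₂ (le_iSup_of_le q (le_iSup_of_le r₁ (le_iSup_of_le r₂
      (le_iSup_of_le ⟨hmax, hprim⟩ le_rfl)))))

/-- **`jSigmaPtLocal` COMMUTES WITH A GALOIS-TYPE MAP** (the shape of GAP 2's `hσ`): `φ : S → S'` flat local, `𝔪S' = 𝔪'`, a trace-descent
datum of `S`-automorphisms; (J-can) at `(S, f)` AND at `(S', φ f)`, (EX) at `(S', φ f)`, `f ∈ 𝔪_S ∖ 0`.  Then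
`jSigmaPtLocal (φ f) m = (jSigmaPtLocal f m)·S'` for every `m`. [cite: Hironaka1967, §3] [OURS · L1 W4.3 · (o53-desc′) (G4) / GAP 2] -/
theorem jSigmaPtLocal_map_eq_of_galois (h𝔪 : (maximalIdeal S).map (algebraMap S S') = maximalIdeal S')
    {κ ι : Type*} [Fintype κ] [Fintype ι] (Γ : κ → (S' ≃ₐ[S] S')) (t : S' → S)
    (ht : ∀ y, algebraMap S S' (t y) = ∑ k, Γ k y) (b c : ι → S')
    (hdual : ∀ x, x = ∑ i, algebraMap S S' (t (x * b i)) * c i) {f : S} (hf0 : f ≠ 0) (hf : f ∈ maximalIdeal S)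
    (hcanS : ∀ (g₁ g₂ : S) (q r₁ r₂ : ℕ) (g₁' g₂' : S) (q' r₁' r₂' : ℕ),
      IsSigmaMaximiser f (adicOrder f).toNat g₁ g₂ q r₁ r₂ → IsPrimitiveTriple q r₁ r₂ →
      IsSigmaMaximiser f (adicOrder f).toNat g₁' g₂' q' r₁' r₂' → IsPrimitiveTriple q' r₁' r₂' →
      ∀ m : ℕ, flagContactFiltration g₁' g₂' q' r₁' r₂' m = flagContactFiltration g₁ g₂ q r₁ r₂ m)
    (hcanS' : ∀ (g₁ g₂ : S') (q r₁ r₂ : ℕ) (g₁' g₂' : S') (q' r₁' r₂' : ℕ),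
      IsSigmaMaximiser (algebraMap S S' f) (adicOrder (algebraMap S S' f)).toNat g₁ g₂ q r₁ r₂ → IsPrimitiveTriple q r₁ r₂ →
      IsSigmaMaximiser (algebraMap S S' f) (adicOrder (algebraMap S S' f)).toNat g₁' g₂' q' r₁' r₂' →
      IsPrimitiveTriple q' r₁' r₂' →
      ∀ m : ℕ, flagContactFiltration g₁' g₂' q' r₁' r₂' m = flagContactFiltration g₁ g₂ q r₁ r₂ m)
    (hexS' : ∃ (g₁ g₂ : S') (q r₁ r₂ : ℕ),
      IsSigmaMaximiser (algebraMap S S' f) (adicOrder (algebraMap S S' f)).toNat g₁ g₂ q r₁ r₂ ∧ IsPrimitiveTriple q r₁ r₂)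
    (m : ℕ) : jSigmaPtLocal (algebraMap S S' f) m = (jSigmaPtLocal f m).map (algebraMap S S') := by
  haveI : IsLocalHom (algebraMap S S') := isLocalHom_of_map_maximalIdeal_eq h𝔪
  obtain ⟨g₁', g₂', q, r₁, r₂, hmax', hprim⟩ := hexS'
  obtain ⟨g₁, g₂, hmax, heq⟩ := exists_isSigmaMaximiser_of_galois h𝔪 Γ t ht b c hdual hcanS' hmax' hprim
  rw [adicOrder_algebraMap_eq_of_flat h𝔪] at hmax
  have hfu : ¬ IsUnit f := (IsLocalRing.mem_maximalIdeal f).mp hf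
  have hf0' : algebraMap S S' f ≠ 0 := fun h =>
    hf0 ((mem_iff_algebraMap_mem_map_of_flat h𝔪 ⊥ f).mpr (by rw [h, Ideal.map_bot]; exact zero_mem _) |>
      (Ideal.mem_bot).mp)
  have hfu' : ¬ IsUnit (algebraMap S S' f) := fun h => hfu ((isUnit_map_iff (algebraMap S S') f).mp h)
  rw [jSigmaPtLocal_eq_of_canonical hf0' hfu' hcanS' hmax' hprim m, jSigmaPtLocal_eq_of_canonical hf0 hfu hcanS hmax hprim m,
    map_flagContactFiltration_eq (algebraMap S S') h𝔪, heq]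

/-! ## §5 The lexicographic comparison is transitive -/

/-- Transitivity of «`(q₁;a₁,b₁) ≤_lex (q₂;a₂,b₂)`» := `a₁ b₂ < a₂ b₁ ∨ (a₁ b₂ = a₂ b₁ ∧ a₁ q₂ ≤ a₂ q₁)` (ratio `a/b` first, level
`a/q` second) for triples with positive entries. [folklore] -/
theorem lexLE_trans {q₁ a₁ b₁ q₂ a₂ b₂ q₃ a₃ b₃ : ℕ} (ha₁ : 0 < a₁) (hq₂ : 0 < q₂) (ha₂ : 0 < a₂) (hb₂ : 0 < b₂)
    (ha₃ : 0 < a₃)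
    (h₁₂ : a₁ * b₂ < a₂ * b₁ ∨ (a₁ * b₂ = a₂ * b₁ ∧ a₁ * q₂ ≤ a₂ * q₁))
    (h₂₃ : a₂ * b₃ < a₃ * b₂ ∨ (a₂ * b₃ = a₃ * b₂ ∧ a₂ * q₃ ≤ a₃ * q₂)) :
    a₁ * b₃ < a₃ * b₁ ∨ (a₁ * b₃ = a₃ * b₁ ∧ a₁ * q₃ ≤ a₃ * q₁) := by
  have hab : 0 < a₂ * b₂ := Nat.mul_pos ha₂ hb₂
  have e₁ : a₂ * b₂ * (a₁ * b₃) = (a₁ * b₂) * (a₂ * b₃) := by ring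
  have e₂ : a₂ * b₂ * (a₃ * b₁) = (a₂ * b₁) * (a₃ * b₂) := by ring
  rcases h₁₂ with h | ⟨h, h'⟩
  · left
    refine Nat.lt_of_mul_lt_mul_left (a := a₂ * b₂) ?_
    rw [e₁, e₂]
    rcases h₂₃ with k | ⟨k, -⟩
    · exact mul_lt_mul'' h k (Nat.zero_le _) (Nat.zero_le _)
    · rw [k]; exact Nat.mul_lt_mul_of_pos_right h (Nat.mul_pos ha₃ hb₂)
  · rcases h₂₃ with k | ⟨k, k'⟩
    · left
      refine Nat.lt_of_mul_lt_mul_left (a := a₂ * b₂) ?_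
      rw [e₁, e₂, ← h]
      exact Nat.mul_lt_mul_of_pos_left k (Nat.mul_pos ha₁ hb₂)
    · right
      constructor
      · refine Nat.eq_of_mul_eq_mul_left hab ?_
        rw [e₁, e₂, h, k]
      · have haq : 0 < a₂ * q₂ := Nat.mul_pos ha₂ hq₂
        refine Nat.le_of_mul_le_mul_left ?_ haq
        have e₃ : a₂ * q₂ * (a₁ * q₃) = (a₁ * q₂) * (a₂ * q₃) := by ring
        have e₄ : a₂ * q₂ * (a₃ * q₁) = (a₂ * q₁) * (a₃ * q₂) := by ring
        rw [e₃, e₄]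
        exact Nat.mul_le_mul h' k'

/-! ## §6 Images of maximisers are maximisers; (J-can) and (EX) descend (upstairs hypotheses only) -/

/-- **Under (J-can)+(EX) upstairs, the image of a σ-maximiser is a σ-maximiser**: the upstairs maximum descends
(`exists_isSigmaMaximiser_of_galois`), so it squeezes every downstairs maximiser. [cite: Hironaka1967, §3] -/
theorem isSigmaMaximiser_algebraMap_of_galois (h𝔪 : (maximalIdeal S).map (algebraMap S S') = maximalIdeal S')
    {κ ι : Type*} [Fintype κ] [Fintype ι] (Γ : κ → (S' ≃ₐ[S] S')) (t : S' → S)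
    (ht : ∀ y, algebraMap S S' (t y) = ∑ k, Γ k y) (b c : ι → S')
    (hdual : ∀ x, x = ∑ i, algebraMap S S' (t (x * b i)) * c i) {f : S}
    (hcan : ∀ (g₁ g₂ : S') (q r₁ r₂ : ℕ) (g₁' g₂' : S') (q' r₁' r₂' : ℕ),
      IsSigmaMaximiser (algebraMap S S' f) (adicOrder (algebraMap S S' f)).toNat g₁ g₂ q r₁ r₂ → IsPrimitiveTriple q r₁ r₂ →
      IsSigmaMaximiser (algebraMap S S' f) (adicOrder (algebraMap S S' f)).toNat g₁' g₂' q' r₁' r₂' →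
      IsPrimitiveTriple q' r₁' r₂' →
      ∀ m : ℕ, flagContactFiltration g₁' g₂' q' r₁' r₂' m = flagContactFiltration g₁ g₂ q r₁ r₂ m)
    (hex : ∃ (g₁ g₂ : S') (q r₁ r₂ : ℕ),
      IsSigmaMaximiser (algebraMap S S' f) (adicOrder (algebraMap S S' f)).toNat g₁ g₂ q r₁ r₂ ∧ IsPrimitiveTriple q r₁ r₂)
    {g₁ g₂ : S} {q r₁ r₂ : ℕ} (hmax : IsSigmaMaximiser f (adicOrder (algebraMap S S' f)).toNat g₁ g₂ q r₁ r₂) :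
    IsSigmaMaximiser (algebraMap S S' f) (adicOrder (algebraMap S S' f)).toNat (algebraMap S S' g₁) (algebraMap S S' g₂)
      q r₁ r₂ := by
  obtain ⟨hadm, hfl, hmem, hlex⟩ := hmax
  refine ⟨hadm, hfl.algebraMap_of_flat h𝔪, map_mem_flagContactFiltration _ h𝔪.le hmem, fun q' r₁' r₂' hadm' hreach' => ?_⟩
  obtain ⟨G₁, G₂, Q, R₁, R₂, hmaxU, hprimU⟩ := hex
  obtain ⟨d₁, d₂, hmaxD, -⟩ := exists_isSigmaMaximiser_of_galois h𝔪 Γ t ht b c hdual hcan hmaxU hprimU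
  have h₂₃ := hlex Q R₁ R₂ hmaxU.1 hmaxD.flagReaches
  have h₁₂ := hmaxU.2.2.2 q' r₁' r₂' hadm' hreach'
  have hR₂ : 0 < R₂ := lt_of_lt_of_le hmaxU.1.1 hmaxU.1.2.1
  exact lexLE_trans (lt_of_lt_of_le (lt_of_lt_of_le hadm'.1 hadm'.2.1) hadm'.2.2) hmaxU.1.1 (lt_of_lt_of_le hR₂ hmaxU.1.2.2) hR₂
    (lt_of_lt_of_le (lt_of_lt_of_le hadm.1 hadm.2.1) hadm.2.2) h₁₂ h₂₃

/-- **(J-can) DESCENDS along a Galois-type map** (given (J-can)+(EX) upstairs). [cite: Hironaka1967, §3] [OURS · L1 W4.3 · (G4′)] -/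
theorem canonical_of_galois (h𝔪 : (maximalIdeal S).map (algebraMap S S') = maximalIdeal S')
    {κ ι : Type*} [Fintype κ] [Fintype ι] (Γ : κ → (S' ≃ₐ[S] S')) (t : S' → S)
    (ht : ∀ y, algebraMap S S' (t y) = ∑ k, Γ k y) (b c : ι → S')
    (hdual : ∀ x, x = ∑ i, algebraMap S S' (t (x * b i)) * c i) {f : S}
    (hcan : ∀ (g₁ g₂ : S') (q r₁ r₂ : ℕ) (g₁' g₂' : S') (q' r₁' r₂' : ℕ),
      IsSigmaMaximiser (algebraMap S S' f) (adicOrder (algebraMap S S' f)).toNat g₁ g₂ q r₁ r₂ → IsPrimitiveTriple q r₁ r₂ →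
      IsSigmaMaximiser (algebraMap S S' f) (adicOrder (algebraMap S S' f)).toNat g₁' g₂' q' r₁' r₂' →
      IsPrimitiveTriple q' r₁' r₂' →
      ∀ m : ℕ, flagContactFiltration g₁' g₂' q' r₁' r₂' m = flagContactFiltration g₁ g₂ q r₁ r₂ m)
    (hex : ∃ (g₁ g₂ : S') (q r₁ r₂ : ℕ),
      IsSigmaMaximiser (algebraMap S S' f) (adicOrder (algebraMap S S' f)).toNat g₁ g₂ q r₁ r₂ ∧ IsPrimitiveTriple q r₁ r₂) :
    ∀ (g₁ g₂ : S) (q r₁ r₂ : ℕ) (g₁' g₂' : S) (q' r₁' r₂' : ℕ),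
      IsSigmaMaximiser f (adicOrder f).toNat g₁ g₂ q r₁ r₂ → IsPrimitiveTriple q r₁ r₂ →
      IsSigmaMaximiser f (adicOrder f).toNat g₁' g₂' q' r₁' r₂' → IsPrimitiveTriple q' r₁' r₂' →
      ∀ m : ℕ, flagContactFiltration g₁' g₂' q' r₁' r₂' m = flagContactFiltration g₁ g₂ q r₁ r₂ m := by
  intro g₁ g₂ q r₁ r₂ g₁' g₂' q' r₁' r₂' hmax₁ hprim₁ hmax₂ hprim₂ m
  rw [← adicOrder_algebraMap_eq_of_flat h𝔪] at hmax₁ hmax₂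
  have h₁ := isSigmaMaximiser_algebraMap_of_galois h𝔪 Γ t ht b c hdual hcan hex hmax₁
  have h₂ := isSigmaMaximiser_algebraMap_of_galois h𝔪 Γ t ht b c hdual hcan hex hmax₂
  have heq := hcan _ _ q r₁ r₂ _ _ q' r₁' r₂' h₁ hprim₁ h₂ hprim₂ m
  ext x
  rw [mem_iff_algebraMap_mem_map_of_flat h𝔪 (flagContactFiltration g₁' g₂' q' r₁' r₂' m) x,
    mem_iff_algebraMap_mem_map_of_flat h𝔪 (flagContactFiltration g₁ g₂ q r₁ r₂ m) x,
    map_flagContactFiltration_eq _ h𝔪, map_flagContactFiltration_eq _ h𝔪, heq]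

/-- **(EX) DESCENDS along a Galois-type map** (given (J-can)+(EX) upstairs). [cite: Hironaka1967, §3] [OURS · L1 W4.3 · (G4′)] -/
theorem exists_of_galois (h𝔪 : (maximalIdeal S).map (algebraMap S S') = maximalIdeal S')
    {κ ι : Type*} [Fintype κ] [Fintype ι] (Γ : κ → (S' ≃ₐ[S] S')) (t : S' → S)
    (ht : ∀ y, algebraMap S S' (t y) = ∑ k, Γ k y) (b c : ι → S')
    (hdual : ∀ x, x = ∑ i, algebraMap S S' (t (x * b i)) * c i) {f : S}
    (hcan : ∀ (g₁ g₂ : S') (q r₁ r₂ : ℕ) (g₁' g₂' : S') (q' r₁' r₂' : ℕ),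
      IsSigmaMaximiser (algebraMap S S' f) (adicOrder (algebraMap S S' f)).toNat g₁ g₂ q r₁ r₂ → IsPrimitiveTriple q r₁ r₂ →
      IsSigmaMaximiser (algebraMap S S' f) (adicOrder (algebraMap S S' f)).toNat g₁' g₂' q' r₁' r₂' →
      IsPrimitiveTriple q' r₁' r₂' →
      ∀ m : ℕ, flagContactFiltration g₁' g₂' q' r₁' r₂' m = flagContactFiltration g₁ g₂ q r₁ r₂ m)
    (hex : ∃ (g₁ g₂ : S') (q r₁ r₂ : ℕ),
      IsSigmaMaximiser (algebraMap S S' f) (adicOrder (algebraMap S S' f)).toNat g₁ g₂ q r₁ r₂ ∧ IsPrimitiveTriple q r₁ r₂) :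
    ∃ (g₁ g₂ : S) (q r₁ r₂ : ℕ), IsSigmaMaximiser f (adicOrder f).toNat g₁ g₂ q r₁ r₂ ∧ IsPrimitiveTriple q r₁ r₂ := by
  obtain ⟨G₁, G₂, q, r₁, r₂, hmaxU, hprimU⟩ := hex
  obtain ⟨g₁, g₂, hmax, -⟩ := exists_isSigmaMaximiser_of_galois h𝔪 Γ t ht b c hdual hcan hmaxU hprimU
  rw [adicOrder_algebraMap_eq_of_flat h𝔪] at hmax
  exact ⟨g₁, g₂, q, r₁, r₂, hmax, hprimU⟩

/-- **`jSigmaPtLocal` commutes with a Galois-type map under UPSTAIRS (J-can)+(EX) only.** [cite: Hironaka1967, §3]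
[OURS · L1 W4.3 · (G4′) / GAP 2] -/
theorem jSigmaPtLocal_map_eq_of_galois' (h𝔪 : (maximalIdeal S).map (algebraMap S S') = maximalIdeal S')
    {κ ι : Type*} [Fintype κ] [Fintype ι] (Γ : κ → (S' ≃ₐ[S] S')) (t : S' → S)
    (ht : ∀ y, algebraMap S S' (t y) = ∑ k, Γ k y) (b c : ι → S')
    (hdual : ∀ x, x = ∑ i, algebraMap S S' (t (x * b i)) * c i) {f : S} (hf0 : f ≠ 0) (hf : f ∈ maximalIdeal S)
    (hcan : ∀ (g₁ g₂ : S') (q r₁ r₂ : ℕ) (g₁' g₂' : S') (q' r₁' r₂' : ℕ),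
      IsSigmaMaximiser (algebraMap S S' f) (adicOrder (algebraMap S S' f)).toNat g₁ g₂ q r₁ r₂ → IsPrimitiveTriple q r₁ r₂ →
      IsSigmaMaximiser (algebraMap S S' f) (adicOrder (algebraMap S S' f)).toNat g₁' g₂' q' r₁' r₂' →
      IsPrimitiveTriple q' r₁' r₂' →
      ∀ m : ℕ, flagContactFiltration g₁' g₂' q' r₁' r₂' m = flagContactFiltration g₁ g₂ q r₁ r₂ m)
    (hex : ∃ (g₁ g₂ : S') (q r₁ r₂ : ℕ),
      IsSigmaMaximiser (algebraMap S S' f) (adicOrder (algebraMap S S' f)).toNat g₁ g₂ q r₁ r₂ ∧ IsPrimitiveTriple q r₁ r₂)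
    (m : ℕ) : jSigmaPtLocal (algebraMap S S' f) m = (jSigmaPtLocal f m).map (algebraMap S S') :=
  jSigmaPtLocal_map_eq_of_galois h𝔪 Γ t ht b c hdual hf0 hf (canonical_of_galois h𝔪 Γ t ht b c hdual hcan hex) hcan hex m

end SigmaGaloisDescent

end Summit.ResolutionOfSingularities.ResolutionOfSingularities.Theorems

end
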